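import Summits.AtomisticToContinuum.BoseEinsteinCondensation.Theorems.BECThomsonPrincipleGaussianDominationCanRayGainMonotone
import HarnessLib

/-!
# Line `coupling-monotone-chord` (crux `GaussianDominationCan`, stmt-AtomisticToContinuum-9479):
# the sign B `SourceRaisesInteraction` in increasing-differences form

Route `BECThomsonPrinciple`.  Supports (does not close) the crux item.  Corollary of the landed ray
equivalence `raySign_iff_gain_monotoneOn` (`…GaussianDominationCanRayGainMonotone`): the line's sign B,
`SourceRaisesInteraction` (`…GaussianDominationCanDefs`; the crux follows from it with the sharp constant,
`gaussianDominationCan_of_sourceRaisesInteraction`, p137266), is EQUIVALENT to the statement that for every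
bounded admissible potential in the dilute window and every source strength `s ≥ 0` the sourced
ground-state energy gain `τ ↦ inf_Φ F_{τ•w, s}(Φ) − inf_Φ F_{τ•w, 0}(Φ)` is non-decreasing along the
coupling ray `τ ∈ (0, 1)` — increasing differences of the sourced ground-state energy in (coupling,
source), a statement about infima of the sourced functional only (no near-minimiser sets).  The class of
bounded measurable potentials of range `R₀` is closed under `τ • ·`, so the ray statement at every `w` of
the class is the pointwise statement at every `w` of the class (`w = ½ • (2 • w)`).
-/

noncomputable section

namespace Summit.AtomisticToContinuum.BoseEinsteinCondensation.Cruxes.GaussianDominationCan.CouplingMonotoneChord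

open MeasureTheory Set
open scoped ENNReal NNReal
open Literature.MathematicalPhysics.QuantumManyBody.BoseGas
open Summit.AtomisticToContinuum.BoseEinsteinCondensation.Theorems.GaussianDominationCan.Negative (InWindow)

/-- Ray points of a measurable potential are measurable. [folklore] -/
theorem measurable_scalePot {w : ℝ → ℝ≥0∞} (hw : Measurable w) (τ : ℝ) : Measurable (scalePot τ w) := by
  unfold scalePot
  exact hw.const_mul _

/-- Ray points inherit the range. [folklore] -/
theorem scalePot_eq_zero_of_range {w : ℝ → ℝ≥0∞} {R₀ : ℝ} (hw : ∀ r, R₀ < r → w r = 0) (τ : ℝ) :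
    ∀ r, R₀ < r → scalePot τ w r = 0 := fun r hr => by
  show ENNReal.ofReal τ * w r = 0
  rw [hw r hr, mul_zero]

/-- `½ • (2 • w) = w`. [folklore] -/
theorem scalePot_half_two (w : ℝ → ℝ≥0∞) : scalePot (1 / 2) (scalePot 2 w) = w := by
  funext r
  simp only [scalePot, ← mul_assoc, ← ENNReal.ofReal_mul (by norm_num : (0 : ℝ) ≤ 1 / 2)]
  norm_num

/-- **The sign B in increasing-differences form** (line `coupling-monotone-chord`, crux
stmt-AtomisticToContinuum-9479; registered side cut S7).  `SourceRaisesInteraction` holds iff for every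
window parameter `M > 0` and range `R₀` there is a density threshold `ρ₀ > 0` such that for every bounded
measurable `w ≥ 0` vanishing beyond `R₀`, every `(m, L, n)` in the dilute window and every `s ≥ 0`, the
sourced ground-state energy gain is non-decreasing along the coupling ray on `(0, 1)`.  Forward: B at the
ray points `τ • w` (again in the class) and `raySign_iff_gain_monotoneOn`; backward: the ray statement for
`2 • w` at `τ = ½`. [folklore] -/
theorem sourceRaisesInteraction_iff_gainMonotone :
    SourceRaisesInteraction ↔
      ∀ M : ℝ, 0 < M → ∀ R₀ : ℝ, ∃ ρ₀ : ℝ, 0 < ρ₀ ∧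
        ∀ w : ℝ → ℝ≥0∞, Measurable w → (∀ r, R₀ < r → w r = 0) → (∃ B : ℝ, ∀ r, w r ≤ ENNReal.ofReal B) →
          ∀ m : ℕ, ∀ L : ℝ, 0 < L → ((m + 1 : ℕ) : ℝ) ≤ ρ₀ * L ^ 3 →
            ∀ n : Fin 3 → ℤ, n ≠ 0 → InWindow M m L n → ∀ s : ℝ, 0 ≤ s →
              MonotoneOn
                (fun τ => (⨅ Φ : PeriodicTrialState (m + 1) L, sourcedFunctional (scalePot τ w) m L n s Φ) -
                  ⨅ Φ : PeriodicTrialState (m + 1) L, sourcedFunctional (scalePot τ w) m L n 0 Φ)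
                (Set.Ioo 0 1) := by
  constructor
  · intro hB M hM R₀
    obtain ⟨ρ₀, hρ₀, h⟩ := hB M hM R₀
    refine ⟨ρ₀, hρ₀, fun w hmeas hrange hbd m L hL hdens n hn hwin => ?_⟩
    refine (raySign_iff_gain_monotoneOn w ⟨hmeas, R₀, hrange⟩ hbd m L hL n hn).1 fun τ hτ _ => ?_
    obtain ⟨B, hB'⟩ := hbd
    exact h (scalePot τ w) (measurable_scalePot hmeas τ) (scalePot_eq_zero_of_range hrange τ)
      ⟨τ * B, scalePot_le hτ.le hB'⟩ m L hL hdens n hn hwin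
  · intro hG M hM R₀
    obtain ⟨ρ₀, hρ₀, h⟩ := hG M hM R₀
    refine ⟨ρ₀, hρ₀, fun w hmeas hrange hbd m L hL hdens n hn hwin => ?_⟩
    obtain ⟨B, hB'⟩ := hbd
    have hbd2 : ∃ B' : ℝ, ∀ r, scalePot 2 w r ≤ ENNReal.ofReal B' :=
      ⟨2 * B, scalePot_le (by norm_num) hB'⟩
    have key := (raySign_iff_gain_monotoneOn (scalePot 2 w)
      ⟨measurable_scalePot hmeas 2, R₀, scalePot_eq_zero_of_range hrange 2⟩ hbd2 m L hL n hn).2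
      (h (scalePot 2 w) (measurable_scalePot hmeas 2) (scalePot_eq_zero_of_range hrange 2) hbd2
        m L hL hdens n hn hwin) (1 / 2) (by norm_num) (by norm_num)
    rwa [scalePot_half_two] at key

end Summit.AtomisticToContinuum.BoseEinsteinCondensation.Cruxes.GaussianDominationCan.CouplingMonotoneChord

end
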